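import Literature.Barriers.MatrixMultiplication.UniversalMethodBarrier
import Literature.Barriers.MatrixMultiplication.TricoloredSumFreeBarrier
import Literature.Computability.AlgebraicComplexity.TensorRestrictionRank
import Literature.Computability.AlgebraicComplexity.TensorMultiples
import HarnessLib

/-!
# Slice rank: the block criterion, relabelling, and `S(T^{⊗n}) ≤ S̃(T)^n`

Topic `Literature/Barriers/MatrixMultiplication`; first file of the PROOF of the catalogue entry
`UniversalMethodBarrier` (Alman 2021 = [Alman2021], Thm. 2.9 ∧ Cor. 2.8 ∧ Thm. 1.3), whose
definitions (`sliceRank = S`, `asymptoticSliceRank = S̃`, `PolyDegeneratesTo`, …) live in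
`UniversalMethodBarrier.lean`. Everything here is PROVED. Monotonicity of `S` under restriction
(`sliceRank_le_of_tensorRestrictsTo`), attainment (`sliceRank_mem`) and Tao's lemma
`S(⟨n⟩) = n` (`sliceRank_unitTensor`) are already in `TricoloredSumFreeBarrier.lean` and are reused,
not restated.

## Content (Alman 2021, §2.6 and Lemma 2.1)

* `sliceRank_le_of_block` — the **block criterion**: a tensor vanishing on `S₁ᶜ × S₂ᶜ × S₃ᶜ` has
  `S ≤ |S₁| + |S₂| + |S₃|` (slice `T·1[a ∈ S₁]` along `x`, `T·1[a ∉ S₁, b ∈ S₂]` along `y`, the rest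
  along `z`); used for Prop. 2.3 in `UniversalMethodBarrierDegenerationSliceRank.lean`.
* `sliceRank_reindex` — invariance under relabelling; `le_sliceRank_of_restrictsTo_unitTensor` —
  `t ≥ ⟨n⟩ ⇒ n ≤ S(t)` (Tao's lemma + monotonicity, Alman Prop. 2.3–2.4).
* `sliceRank_pow_rpow_le_card`, `sliceRank_pow_rpow_le_asymptoticSliceRank`,
  `asymptoticSliceRank_le_card`, `sliceRank_pow_le_asymptoticSliceRank_pow` —
  `S(T^{⊗(n+1)}) ≤ S̃(T)^{n+1} ≤ |X|^{n+1}` (definition of `S̃` as a bounded supremum).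
* `sum_rotate₃` — binder rotation of a triple finite sum (bookkeeping).

## References

* J. Alman, *Limits on the Universal Method for Matrix Multiplication*, Theory of Computing 17
  (2021), §2.6, Lemma 2.1, Prop. 2.3–2.4 (held: `doi-10-4086-toc-2021-v017a001`, pp. 11–13). [Alman2021]
-/

noncomputable section

open scoped BigOperators

namespace Literature.Barriers.MatrixMultiplication

open Literature.Computability.AlgebraicComplexity

universe u

section Basic

variable {K : Type u} [CommSemiring K]
variable {ι κ μ ι' κ' μ' : Type*}

/-- Rotating a triple finite sum: the last binder moves to the front. [folklore] -/
theorem sum_rotate₃ {M : Type*} [AddCommMonoid M] {α β γ : Type*} [Fintype α] [Fintype β]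
    [Fintype γ] (f : α → β → γ → M) :
    ∑ a, ∑ b, ∑ c, f a b c = ∑ c, ∑ a, ∑ b, f a b c := by
  have h1 : ∀ a, ∑ b, ∑ c, f a b c = ∑ c, ∑ b, f a b c := fun a => Finset.sum_comm
  simp_rw [h1]
  exact Finset.sum_comm

/-- Slice rank is invariant under relabelling the coordinates. [cite: Alman2021, §2.6] -/
theorem sliceRank_reindex [Fintype ι] [Fintype κ] [Fintype μ] [Fintype ι'] [Fintype κ']
    [Fintype μ'] [DecidableEq ι] [DecidableEq κ] [DecidableEq μ] [DecidableEq ι'] [DecidableEq κ']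
    [DecidableEq μ'] (t : ι → κ → μ → K) (e₁ : ι' ≃ ι) (e₂ : κ' ≃ κ) (e₃ : μ' ≃ μ) :
    sliceRank (fun a b c => t (e₁ a) (e₂ b) (e₃ c)) = sliceRank t :=
  le_antisymm (sliceRank_le_of_tensorRestrictsTo (tensorRestrictsTo_precomp t e₁ e₂ e₃))
    (sliceRank_le_of_tensorRestrictsTo (tensorRestrictsTo_of_reindex t e₁ e₂ e₃))

/-- **Block criterion**: a tensor vanishing on the block `S₁ᶜ × S₂ᶜ × S₃ᶜ` has
`S(T) ≤ |S₁| + |S₂| + |S₃|` — slice `T·1[a ∈ S₁]` along `x`, `T·1[a ∉ S₁, b ∈ S₂]` along `y`,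
`T·1[a ∉ S₁, b ∉ S₂, c ∈ S₃]` along `z`. [folklore] -/
theorem sliceRank_le_of_block [DecidableEq ι] [DecidableEq κ] [DecidableEq μ]
    (t : ι → κ → μ → K) (S₁ : Finset ι) (S₂ : Finset κ) (S₃ : Finset μ)
    (h : ∀ a b c, a ∉ S₁ → b ∉ S₂ → c ∉ S₃ → t a b c = 0) :
    sliceRank t ≤ S₁.card + S₂.card + S₃.card := by
  refine sliceRank_le_of_eq (fun i a => if a = S₁.equivFin.symm i then 1 else 0)
    (fun i b c => t (S₁.equivFin.symm i) b c)
    (fun i b => if b = S₂.equivFin.symm i then 1 else 0)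
    (fun i a c => if a ∈ S₁ then 0 else t a (S₂.equivFin.symm i) c)
    (fun i c => if c = S₃.equivFin.symm i then 1 else 0)
    (fun i a b => if a ∈ S₁ ∨ b ∈ S₂ then 0 else t a b (S₃.equivFin.symm i)) ?_
  funext a b c
  -- each of the three sums has at most one non-zero term
  have hx : (∑ i, (if a = S₁.equivFin.symm i then (1 : K) else 0) * t (S₁.equivFin.symm i) b c) =
      if a ∈ S₁ then t a b c else 0 := by
    split_ifs with ha
    · rw [Finset.sum_eq_single (S₁.equivFin ⟨a, ha⟩)]
      · simp
      · intro i _ hi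
        have : a ≠ S₁.equivFin.symm i := fun e => hi (by
          rw [show (⟨a, ha⟩ : {x // x ∈ S₁}) = S₁.equivFin.symm i from Subtype.ext e,
            Equiv.apply_symm_apply])
        simp [this]
      · simp
    · refine Finset.sum_eq_zero fun i _ => ?_
      have : a ≠ S₁.equivFin.symm i := fun e => ha (e ▸ (S₁.equivFin.symm i).2)
      simp [this]
  have hy : (∑ i, (if b = S₂.equivFin.symm i then (1 : K) else 0) *
      (if a ∈ S₁ then 0 else t a (S₂.equivFin.symm i) c)) =
      if a ∈ S₁ then 0 else if b ∈ S₂ then t a b c else 0 := by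
    split_ifs with ha hb
    · simp
    · rw [Finset.sum_eq_single (S₂.equivFin ⟨b, hb⟩)]
      · simp
      · intro i _ hi
        have : b ≠ S₂.equivFin.symm i := fun e => hi (by
          rw [show (⟨b, hb⟩ : {x // x ∈ S₂}) = S₂.equivFin.symm i from Subtype.ext e,
            Equiv.apply_symm_apply])
        simp [this]
      · simp
    · refine Finset.sum_eq_zero fun i _ => ?_
      have : b ≠ S₂.equivFin.symm i := fun e => hb (e ▸ (S₂.equivFin.symm i).2)
      simp [this]
  have hz : (∑ i, (if c = S₃.equivFin.symm i then (1 : K) else 0) *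
      (if a ∈ S₁ ∨ b ∈ S₂ then 0 else t a b (S₃.equivFin.symm i))) =
      if a ∈ S₁ ∨ b ∈ S₂ then 0 else if c ∈ S₃ then t a b c else 0 := by
    split_ifs with hab hc
    · simp
    · rw [Finset.sum_eq_single (S₃.equivFin ⟨c, hc⟩)]
      · simp
      · intro i _ hi
        have : c ≠ S₃.equivFin.symm i := fun e => hi (by
          rw [show (⟨c, hc⟩ : {x // x ∈ S₃}) = S₃.equivFin.symm i from Subtype.ext e,
            Equiv.apply_symm_apply])
        simp [this]
      · simp
    · refine Finset.sum_eq_zero fun i _ => ?_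
      have : c ≠ S₃.equivFin.symm i := fun e => hc (e ▸ (S₃.equivFin.symm i).2)
      simp [this]
  rw [hx, hy, hz]
  by_cases ha : a ∈ S₁
  · simp [ha]
  · by_cases hb : b ∈ S₂
    · simp [ha, hb]
    · by_cases hc : c ∈ S₃
      · simp [ha, hb, hc]
      · simp [ha, hb, hc, h a b c ha hb hc]

/-- A restriction of `t` to `⟨n⟩` certifies `n ≤ S(t)` (Tao's lemma `S(⟨n⟩) = n` and monotonicity;
Alman 2021, Prop. 2.3–2.4). [cite: Alman2021, Prop. 2.4] -/
theorem le_sliceRank_of_restrictsTo_unitTensor {K : Type u} [Field K] [Fintype ι] [Fintype κ]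
    [Fintype μ] {t : ι → κ → μ → K} {n : ℕ} (h : TensorRestrictsTo t (unitTensor K n)) :
    n ≤ sliceRank t :=
  (sliceRank_unitTensor (K := K) n).symm.le.trans (sliceRank_le_of_tensorRestrictsTo h)

end Basic

/-! ## The asymptotic slice rank dominates normalised slice ranks of powers -/

section Asymptotic

variable {K : Type u} [CommSemiring K]
variable {ι κ μ : Type*} [Fintype ι]

/-- `S(T^{⊗(n+1)})^{1/(n+1)} ≤ |X|` (from `S ≤ |X|ⁿ⁺¹`, Alman Lemma 2.1(5)). [cite: Alman2021, Lemma 2.1] -/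
theorem sliceRank_pow_rpow_le_card (t : ι → κ → μ → K) (n : ℕ) :
    ((sliceRank (kroneckerPow t (n + 1)) : ℝ) ^ (1 / ((n : ℝ) + 1))) ≤ Fintype.card ι := by
  have h1 : (sliceRank (kroneckerPow t (n + 1)) : ℝ) ≤ (Fintype.card ι : ℝ) ^ (n + 1) := by
    have := sliceRank_le_card (kroneckerPow t (n + 1))
    rw [Fintype.card_fun, Fintype.card_fin] at this
    exact_mod_cast this
  have hexp : (1 / ((n : ℝ) + 1)) = (((n + 1 : ℕ) : ℝ))⁻¹ := by push_cast; ring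
  calc ((sliceRank (kroneckerPow t (n + 1)) : ℝ) ^ (1 / ((n : ℝ) + 1)))
      ≤ ((Fintype.card ι : ℝ) ^ (n + 1)) ^ (1 / ((n : ℝ) + 1)) :=
        Real.rpow_le_rpow (Nat.cast_nonneg _) h1 (by positivity)
    _ = Fintype.card ι := by
        rw [hexp, Real.pow_rpow_inv_natCast (Nat.cast_nonneg _) (Nat.succ_ne_zero n)]

/-- The sequence defining `S̃(T)` is bounded (by `|X|`). [cite: Alman2021, Lemma 2.1] -/
theorem bddAbove_range_sliceRank_pow_rpow (t : ι → κ → μ → K) :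
    BddAbove (Set.range fun n : ℕ =>
      ((sliceRank (kroneckerPow t (n + 1)) : ℝ) ^ (1 / ((n : ℝ) + 1)))) :=
  ⟨Fintype.card ι, by rintro _ ⟨n, rfl⟩; exact sliceRank_pow_rpow_le_card t n⟩

/-- `S(T^{⊗(n+1)})^{1/(n+1)} ≤ S̃(T)` (definition of `S̃` as a supremum). [cite: Alman2021, §2.6] -/
theorem sliceRank_pow_rpow_le_asymptoticSliceRank (t : ι → κ → μ → K) (n : ℕ) :
    ((sliceRank (kroneckerPow t (n + 1)) : ℝ) ^ (1 / ((n : ℝ) + 1))) ≤ asymptoticSliceRank t :=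
  le_ciSup (bddAbove_range_sliceRank_pow_rpow t) n

/-- `S̃(T) ≤ |X|`. [cite: Alman2021, Lemma 2.1] -/
theorem asymptoticSliceRank_le_card (t : ι → κ → μ → K) : asymptoticSliceRank t ≤ Fintype.card ι :=
  ciSup_le fun n => sliceRank_pow_rpow_le_card t n

/-- **`S(T^{⊗(n+1)}) ≤ S̃(T)^{n+1}`**. [cite: Alman2021, §2.6] -/
theorem sliceRank_pow_le_asymptoticSliceRank_pow (t : ι → κ → μ → K) (n : ℕ) :
    (sliceRank (kroneckerPow t (n + 1)) : ℝ) ≤ asymptoticSliceRank t ^ (n + 1) := by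
  have h := sliceRank_pow_rpow_le_asymptoticSliceRank t n
  have h0 : (0 : ℝ) ≤ ((sliceRank (kroneckerPow t (n + 1)) : ℝ) ^ (1 / ((n : ℝ) + 1))) := by
    positivity
  have hexp : (1 / ((n : ℝ) + 1)) = (((n + 1 : ℕ) : ℝ))⁻¹ := by push_cast; ring
  calc (sliceRank (kroneckerPow t (n + 1)) : ℝ)
      = (((sliceRank (kroneckerPow t (n + 1)) : ℝ) ^ (1 / ((n : ℝ) + 1)))) ^ (n + 1) := by
        rw [hexp, Real.rpow_inv_natCast_pow (Nat.cast_nonneg _) (Nat.succ_ne_zero n)]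
    _ ≤ asymptoticSliceRank t ^ (n + 1) := pow_le_pow_left₀ h0 h (n + 1)

end Asymptotic

end Literature.Barriers.MatrixMultiplication

end
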